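import Mathlib
import Literature.MathematicalPhysics.StatisticalMechanics.CrystallizationSymmetries
import Summits.AtomisticToContinuum.Crystallization.Theorems.MinMeanCycleStackingLockBarlowEnergyIdentification
import Summits.AtomisticToContinuum.Crystallization.Theorems.ChargedEnergyGap.Negative.BlocksBound

/-!
# Route `NashClassCertificates`, crux `NashNearField` (stmt-AtomisticToContinuum-16827), line `birth`:
# pieces for the stub `stub_cauchyBornBarlowCoercivity` (CBBC, the `k = 0` Cauchy–Born landscape coercivity)

CBBC: there is `κ > 0` such that for every periodic Hägg word `s`, every invertible linear `G` in the `4/5–6/5`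
tube and every `r ≥ 0`, if `G` is `r`-far (on the unit-template sites of norm `≤ 3`) from every box-scaled
isometric copy `A ∘ diag(a, a, h/h₀)` of the template (`47/50 ≤ a ≤ 1`, `39a/50 ≤ h ≤ 17a/20`, `h₀ = √6/3`), then
the homogeneously deformed crystal `G · (Barlow stacking of s at unit spacing)` has Lennard-Jones energy per
particle `≥ e* + κ r²`, `e* = ⨅_Q e(Q)` over periodic configurations.

This file lands the provable interfaces around the certified numerics and reduces CBBC to ONE explicit
inequality between lattice sums of the strained stackings (`LatticeLandscape`, the hypothesis of
`stub_cauchyBornBarlowCoercivity_of_latticeLandscape`; registered stub pieces `stub_energyPerParticleLinearImageBarlow`,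
`stub_energyPerParticleLinearImageOfRealizes`, `stub_cauchyBornBarlowCoercivity_of_latticeLandscape`):

* `tsum_points_barlow_eq_tsum_of_eq_zero` — the punctured sum of any function over the point set of
  `barlowPeriodicConfiguration`, seen from a motif point, is the full `ℤ³`-parametrised sum through `barlowPos`
  (the function vanishing at the base point);
* `energyPerParticle_linearImage_barlow_eq_average` — **energy identification for homogeneously deformed Barlow
  stackings**: for every continuous linear automorphism `G` of `ℝ³` and every pair potential `V` with `V 0 = 0`,
  `e((barlowPeriodicConfiguration s).linearImage G) = p⁻¹ ∑_{m<p} ½ ∑'_{q ∈ ℤ³} V(dist (G x_m) (G x_q))`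
  (`x_m = barlowPos a h s m 0 0`; generalises `energyPerParticle_barlow_eq_average`, which is the case `G = id`);
* `energyPerParticle_linearImage_barlow_of_realizes` (`'`) — on the box family the excess vanishes exactly: if
  `G p₁ = A p_{a,h}` at every unit-template site then `e(G · unit stacking) = p⁻¹∑_{m<p} barlowSiteEnergy a h s m
  = e(barlowPeriodicConfiguration s a h)`;
* `stub_cauchyBornBarlowCoercivity_of_latticeLandscape` — **CBBC from the lattice-sum landscape inequality**:
  if for some `κ > 0`, every periodic Hägg word and every `G` in the tube there is a box cell `(A, a, h)` with
  `p⁻¹∑_{m<p} barlowSiteEnergy(a, h, s, m) + κ·dist(G p₁, A p_{a,h})² ≤ p⁻¹∑_{m<p} ½∑'_q V_LJ(dist (G x_m) (G x_q))`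
  at every unit-template site `p₁` of norm `≤ 3`, then CBBC holds with the same `κ`: the far-from-family premise
  produces the witness site, `e* ≤ e(barlowPeriodicConfiguration s a h) = p⁻¹∑ barlowSiteEnergy`
  (`ciInf_le`, `energyPerParticle_barlow_eq_average`) and the right-hand side is the energy of the linear image.
  So `e*` never has to be known, and what remains of CBBC is a statement about explicit lattice sums of the
  strained stackings (certified elastic constants near the optimal cell, a positive gap away from it, uniformly in
  the word through the `k⁻⁴` decay of the interlayer terms).

## Truth audit of `LatticeLandscape` (plain-python lattice sums, template radius 7 + continuum tail; scratch
`work/stubs/scratch/cbbc/`): per word `s` let `m_s = min_box e_s(a, h)` and `R(G) = min_{A,a,h} max_{‖p₁‖≤3}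
|G p₁ − A p_{a,h}|`.  (i) The `6 × 6` strain Hessian of `G ↦ e_s(G)` at the family optimum (rotations factored) is
positive definite for fcc, hcp, dhcp, 9R and period-6 words: smallest eigenvalue of `½H` = 2.39 (fcc; the `C₁₄`-type
coupling of basal and prismatic shears is largest there), 3.63 (hcp), 3.42 (9R); largest 8.6–9.2.  (ii) The binding
constraint on `κ` is NOT near the family but at the tube wall on the fcc `(111)[11̄2]` twinning-shear path: the
homogeneous shear `γ = |w|/h₀ = 1/√2` maps the fcc stacking `s ≡ 1` onto its twin `s ≡ −1` (same frame), where the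
excess `e_fcc(G) − m_fcc` vanishes with `R ≈ 1.04`, but its smallest singular value `0.687 < 4/5` puts it outside the
tube; the barrier is `0.047`/site at `γ/2` (singular values `0.815, 0.971, 1.158`), the tube wall `σ_min = 4/5` is
reached at `0.55 γ` with excess `0.046`, `R = 0.56` (ratio `0.148`), and relaxing the other strain components at the
wall lowers the ratio `(e − m_s)/R²` to `≈ 0.11` (fcc) — versus `≈ 0.24` for hcp and `0.66` for the near-family
basal-shear bound of the B″ audit.  So `κ ≤ 0.1` is what the numerics can deliver, and the tube constant `4/5`
(not the box) is what excludes the zero-excess twin.  (iii) Along the axial paths (iso-scale `0.8–1.2`, c-axis,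
in-plane, Bain-like, deviatoric up to `±0.2`) the ratio stays `≥ 0.55`; `e(0.8·I) − m ≈ +3.5`, `e(1.2·I) − m ≈ 0.37`.
(iv) Word-uniformity: optimal cells `a_s ∈ [0.97123, 0.97127]`, `h_s/a_s ∈ [0.81638, 0.81650]`, moduli agree to
`10⁻³`; no word-dependent soft mode (interlayer terms decay like `k⁻⁴`).
-/

noncomputable section

open scoped BigOperators
open Literature.MathematicalPhysics.StatisticalMechanics Literature.Geometry.DiscreteGeometry

namespace Summit.AtomisticToContinuum.Crystallization.Theorems.NashClassCertificatesNashNearField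

open Summit.AtomisticToContinuum.Crystallization.Theorems (barlowPos_injective energyPerParticle_barlow_eq_average)
open Summit.AtomisticToContinuum.Crystallization.Theorems.ChargedEnergyGapNegative
  (bddBelow_energyPerParticle_lennardJones)

section LinearImage

variable {a h : ℝ} {s : ℤ → ℤ} {p : ℕ}

/-- **The punctured sum over a Barlow stacking seen from a motif point is the full `ℤ³`-parametrised sum**
(through the bijection `barlowPos`; the function is required to vanish at the base point, which is the
missing diagonal term). [folklore] -/
theorem tsum_points_barlow_eq_tsum_of_eq_zero (ha : 0 < a) (hh : 0 < h) (ha' : a ≠ 0) (hh' : h ≠ 0)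
    (hp : p ≠ 0) (hs : ∀ i, s (i + p) = s i) (m : ℤ) (f : EuclideanSpace ℝ (Fin 3) → ℝ)
    (hf : f (barlowPos a h s m 0 0) = 0) :
    ∑' y : {y // y ∈ (barlowPeriodicConfiguration s ha' hh' hp hs).points ∧ y ≠ barlowPos a h s m 0 0},
        f y.1 = ∑' q : ℤ × ℤ × ℤ, f (barlowPos a h s q.1 q.2.1 q.2.2) := by
  -- adapted from `tsum_points_eq_tsum_barlowPos` (MinMeanCycleStackingLockBarlowEnergyIdentification)
  set P := barlowPeriodicConfiguration s ha' hh' hp hs with hPdef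
  have hP : P.points = barlowStacking a h s := barlowPeriodicConfiguration_points s ha' hh' hp hs
  set g : ℤ × ℤ × ℤ → EuclideanSpace ℝ (Fin 3) := fun q => barlowPos a h s q.1 q.2.1 q.2.2 with hgdef
  have hg : Function.Injective g := barlowPos_injective ha hh s
  set q₀ : ℤ × ℤ × ℤ := (m, 0, 0) with hq₀
  have hx : g q₀ = barlowPos a h s m 0 0 := rfl
  have hmem : ∀ q, g q ∈ P.points := fun q => by
    rw [hP]
    exact barlowPos_mem _ _ _
  let φ : ↥({q₀}ᶜ : Set (ℤ × ℤ × ℤ)) → {y // y ∈ P.points ∧ y ≠ barlowPos a h s m 0 0} :=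
    fun c => ⟨g c.1, hmem c.1, fun hc => c.2 (hg (hc.trans hx.symm))⟩
  have hφ : Function.Injective φ := by
    intro c c' hcc'
    have h1 : g c.1 = g c'.1 := congrArg Subtype.val hcc'
    exact Subtype.ext (hg h1)
  have hsurj : Function.support
      (fun y : {y // y ∈ P.points ∧ y ≠ barlowPos a h s m 0 0} => f y.1) ⊆ Set.range φ := by
    intro y _
    have hy : y.1 ∈ barlowStacking a h s := by
      rw [← hP]
      exact y.2.1
    obtain ⟨k, i, j, hk⟩ := hy
    have hne : ((k, i, j) : ℤ × ℤ × ℤ) ∈ ({q₀}ᶜ : Set (ℤ × ℤ × ℤ)) := by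
      intro hq
      have hq' : g (k, i, j) = g q₀ := by rw [Set.mem_singleton_iff.1 hq]
      exact y.2.2 (hk.trans (hq'.trans hx))
    exact ⟨⟨(k, i, j), hne⟩, Subtype.ext hk.symm⟩
  have key := hφ.tsum_eq hsurj
  rw [← key]
  have h0 : Function.support (fun q : ℤ × ℤ × ℤ => f (g q)) ⊆ ({q₀}ᶜ : Set (ℤ × ℤ × ℤ)) := by
    intro q hq
    rw [Function.mem_support] at hq
    simp only [Set.mem_compl_iff, Set.mem_singleton_iff]
    rintro rfl
    exact hq (by rw [hx, hf])
  exact tsum_subtype_eq_of_support_subset h0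

/-- **Energy identification for homogeneously deformed Barlow stackings.**  For `a, h > 0`, a `p`-periodic
sequence `s`, a pair potential `V` with `V 0 = 0` and a continuous linear automorphism `G` of `ℝ³`, the energy per
particle of the linear image `G · barlowPeriodicConfiguration s` is the period average of the deformed site lattice
sums: `e = p⁻¹ ∑_{m<p} ½ ∑'_{q ∈ ℤ³} V (dist (G x_m) (G x_q))`, `x_q = barlowPos a h s q`. [folklore] -/
theorem energyPerParticle_linearImage_barlow_eq_average (V : ℝ → ℝ) (hV0 : V 0 = 0) (ha : 0 < a)
    (hh : 0 < h) (ha' : a ≠ 0) (hh' : h ≠ 0) (hp : p ≠ 0) (hs : ∀ i, s (i + p) = s i)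
    (G : EuclideanSpace ℝ (Fin 3) ≃L[ℝ] EuclideanSpace ℝ (Fin 3)) :
    ((barlowPeriodicConfiguration s ha' hh' hp hs).linearImage G).energyPerParticle V =
      (∑ m ∈ Finset.range p, (1 / 2 : ℝ) * ∑' q : ℤ × ℤ × ℤ,
        V (dist (G (barlowPos a h s m 0 0)) (G (barlowPos a h s q.1 q.2.1 q.2.2)))) / p := by
  set P := barlowPeriodicConfiguration s ha' hh' hp hs with hPdef
  have hmotif : P.motif = (Finset.range p).image fun m : ℕ => barlowPos a h s m 0 0 := by
    ext y
    simp only [hPdef, barlowPeriodicConfiguration, Finset.mem_image, Finset.mem_range]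
  have hinj : Function.Injective fun m : ℕ => barlowPos a h s m 0 0 := by
    intro m m' hmm'
    have h2 := congrArg (fun v : EuclideanSpace ℝ (Fin 3) => v 2) hmm'
    simp only [barlowPos_apply_two, Int.cast_natCast] at h2
    exact_mod_cast mul_right_cancel₀ hh' h2
  have hmotif' : (P.linearImage G).motif = P.motif.map ⟨G, G.injective⟩ := rfl
  -- the punctured sum seen from `G x` is the punctured sum over the undeformed stacking seen from `x`
  have htr : ∀ x : EuclideanSpace ℝ (Fin 3),
      ∑' y : {y // y ∈ (P.linearImage G).points ∧ y ≠ G x}, V (dist (G x) y.1) =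
        ∑' y : {y // y ∈ P.points ∧ y ≠ x}, V (dist (G x) (G y.1)) := by
    intro x
    let e : {y // y ∈ P.points ∧ y ≠ x} ≃ {y // y ∈ (P.linearImage G).points ∧ y ≠ G x} :=
      G.toLinearEquiv.toEquiv.subtypeEquiv fun y => by
        simp only [ne_eq, PeriodicConfiguration.mem_points_linearImage, LinearEquiv.coe_toEquiv,
          ContinuousLinearEquiv.coe_toLinearEquiv, ContinuousLinearEquiv.symm_apply_apply,
          G.injective.eq_iff]
    rw [← Equiv.tsum_eq e]
    rfl
  have e1 : ∑ x ∈ P.motif.map ⟨G, G.injective⟩,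
      ∑' y : {y // y ∈ (P.linearImage G).points ∧ y ≠ x}, V (dist x y.1) =
      ∑ m ∈ Finset.range p, ∑' q : ℤ × ℤ × ℤ,
        V (dist (G (barlowPos a h s m 0 0)) (G (barlowPos a h s q.1 q.2.1 q.2.2))) := by
    rw [Finset.sum_map, hmotif, Finset.sum_image fun x _ y _ hxy => hinj hxy]
    refine Finset.sum_congr rfl fun m _ => ?_
    simp only [Function.Embedding.coeFn_mk]
    rw [htr]
    exact tsum_points_barlow_eq_tsum_of_eq_zero ha hh ha' hh' hp hs m
      (fun y => V (dist (G (barlowPos a h s m 0 0)) (G y))) (by simp [hV0])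
  rw [PeriodicConfiguration.energyPerParticle, PeriodicConfiguration.card_motif_linearImage, hmotif', e1,
    hmotif, Finset.card_image_of_injective _ hinj, Finset.card_range, ← Finset.mul_sum]
  ring

end LinearImage

/-- `√6/3 ≠ 0`. [folklore] -/
theorem cbbc_sqrt_six_div_three_pos : (0 : ℝ) < Real.sqrt 6 / 3 := by positivity

/-- **On the family the deformed energy is the Barlow energy of the cell.**  If a continuous linear automorphism
`G` realises a box-scaled isometric template on the unit-template sites (`G p₁ = A p_{a,h}` at every site, `A` a
linear isometry, `a, h > 0`), then the energy per particle of `G · (unit Barlow stacking of s)` is the period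
average of `barlowSiteEnergy V_LJ a h s`, i.e. the energy per particle of `barlowPeriodicConfiguration s a h`
(`energyPerParticle_barlow_eq_average`): the reference value on the left of the lattice-sum landscape inequality is
the value of its right-hand side at the realiser, so the landscape inequality is an inequality for ONE explicit
function of the strain. [folklore] -/
theorem energyPerParticle_linearImage_barlow_of_realizes {a h : ℝ} {s : ℤ → ℤ} {p : ℕ} (ha : 0 < a) (hh : 0 < h)
    (hp : p ≠ 0) (hs : ∀ i, s (i + p) = s i) (hh₀ : Real.sqrt 6 / 3 ≠ 0)
    (G : EuclideanSpace ℝ (Fin 3) ≃L[ℝ] EuclideanSpace ℝ (Fin 3))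
    (A : EuclideanSpace ℝ (Fin 3) →ₗᵢ[ℝ] EuclideanSpace ℝ (Fin 3))
    (hG : ∀ m u v : ℤ, G (barlowPos 1 (Real.sqrt 6 / 3) s m u v) = A (barlowPos a h s m u v)) :
    ((barlowPeriodicConfiguration s one_ne_zero hh₀ hp hs).linearImage G).energyPerParticle lennardJones =
      (∑ m ∈ Finset.range p, barlowSiteEnergy lennardJones a h s m) / p := by
  rw [energyPerParticle_linearImage_barlow_eq_average lennardJones lennardJones_zero one_pos
    cbbc_sqrt_six_div_three_pos one_ne_zero hh₀ hp hs G]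
  congr 1
  refine Finset.sum_congr rfl fun m _ => ?_
  have h2 := Summit.AtomisticToContinuum.Crystallization.Theorems.tsum_points_eq_two_mul_barlowSiteEnergy
    ha hh ha.ne' hh.ne' hp hs (m : ℤ)
  rw [Summit.AtomisticToContinuum.Crystallization.Theorems.tsum_points_eq_tsum_barlowPos
    ha hh ha.ne' hh.ne' hp hs (m : ℤ)] at h2
  have h3 : ∑' q : ℤ × ℤ × ℤ, lennardJones (dist (G (barlowPos 1 (Real.sqrt 6 / 3) s m 0 0))
      (G (barlowPos 1 (Real.sqrt 6 / 3) s q.1 q.2.1 q.2.2))) =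
      ∑' q : ℤ × ℤ × ℤ, lennardJones (dist (barlowPos a h s m 0 0) (barlowPos a h s q.1 q.2.1 q.2.2)) :=
    tsum_congr fun q => by rw [hG, hG, LinearIsometry.dist_map]
  rw [h3, h2]
  ring

/-- Hence a realiser of a box-scaled isometric template has exactly the energy per particle of the Barlow stacking
of the same word at that cell: the box family is contained in the zero set of the landscape excess. [folklore] -/
theorem energyPerParticle_linearImage_barlow_of_realizes' {a h : ℝ} {s : ℤ → ℤ} {p : ℕ} (ha : 0 < a) (hh : 0 < h)
    (hp : p ≠ 0) (hs : ∀ i, s (i + p) = s i) (hh₀ : Real.sqrt 6 / 3 ≠ 0)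
    (G : EuclideanSpace ℝ (Fin 3) ≃L[ℝ] EuclideanSpace ℝ (Fin 3))
    (A : EuclideanSpace ℝ (Fin 3) →ₗᵢ[ℝ] EuclideanSpace ℝ (Fin 3))
    (hG : ∀ m u v : ℤ, G (barlowPos 1 (Real.sqrt 6 / 3) s m u v) = A (barlowPos a h s m u v)) :
    ((barlowPeriodicConfiguration s one_ne_zero hh₀ hp hs).linearImage G).energyPerParticle lennardJones =
      (barlowPeriodicConfiguration s ha.ne' hh.ne' hp hs).energyPerParticle lennardJones := by
  rw [energyPerParticle_linearImage_barlow_of_realizes ha hh hp hs hh₀ G A hG,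
    energyPerParticle_barlow_eq_average ha hh ha.ne' hh.ne' hp hs]

/-- **Stub piece `stub_energyPerParticleLinearImageBarlow` (proved; registered form of
`energyPerParticle_linearImage_barlow_eq_average`).** [folklore] -/
theorem stub_energyPerParticleLinearImageBarlow :
    ∀ (V : ℝ → ℝ) (a h : ℝ) (s : ℤ → ℤ) (p : ℕ) (ha : 0 < a) (hh : 0 < h) (hp : p ≠ 0) (hs : ∀ i, s (i + p) = s i)
      (G : EuclideanSpace ℝ (Fin 3) ≃L[ℝ] EuclideanSpace ℝ (Fin 3)), V 0 = 0 →
      ((barlowPeriodicConfiguration s ha.ne' hh.ne' hp hs).linearImage G).energyPerParticle V =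
        (∑ m ∈ Finset.range p, (1 / 2 : ℝ) * ∑' q : ℤ × ℤ × ℤ,
          V (dist (G (barlowPos a h s m 0 0)) (G (barlowPos a h s q.1 q.2.1 q.2.2)))) / p :=
  fun V _ _ _ _ ha hh hp hs G hV0 =>
    energyPerParticle_linearImage_barlow_eq_average V hV0 ha hh ha.ne' hh.ne' hp hs G

/-- **Stub piece `stub_energyPerParticleLinearImageOfRealizes` (proved; registered form of
`energyPerParticle_linearImage_barlow_of_realizes`/`'`): on the box family the deformed unit stacking has exactly
the Lennard-Jones energy per particle of the Barlow stacking of the same word at that cell.** [folklore] -/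
theorem stub_energyPerParticleLinearImageOfRealizes :
    ∀ (a h : ℝ) (s : ℤ → ℤ) (p : ℕ) (ha : 0 < a) (hh : 0 < h) (hp : p ≠ 0) (hs : ∀ i, s (i + p) = s i)
      (G : EuclideanSpace ℝ (Fin 3) ≃L[ℝ] EuclideanSpace ℝ (Fin 3))
      (A : EuclideanSpace ℝ (Fin 3) →ₗᵢ[ℝ] EuclideanSpace ℝ (Fin 3)),
      (∀ m u v : ℤ, G (barlowPos 1 (Real.sqrt 6 / 3) s m u v) = A (barlowPos a h s m u v)) →
      ((barlowPeriodicConfiguration s one_ne_zero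
          (div_ne_zero (Real.sqrt_ne_zero'.2 (by norm_num)) three_ne_zero : Real.sqrt 6 / 3 ≠ 0) hp hs).linearImage
        G).energyPerParticle lennardJones =
        (barlowPeriodicConfiguration s ha.ne' hh.ne' hp hs).energyPerParticle lennardJones ∧
      ((barlowPeriodicConfiguration s one_ne_zero
          (div_ne_zero (Real.sqrt_ne_zero'.2 (by norm_num)) three_ne_zero : Real.sqrt 6 / 3 ≠ 0) hp hs).linearImage
        G).energyPerParticle lennardJones =
        (∑ m ∈ Finset.range p, barlowSiteEnergy lennardJones a h s m) / p :=
  fun _ _ _ _ ha hh hp hs G A hG =>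
    ⟨energyPerParticle_linearImage_barlow_of_realizes' ha hh hp hs _ G A hG,
      energyPerParticle_linearImage_barlow_of_realizes ha hh hp hs _ G A hG⟩

/-- **CBBC from the lattice-sum landscape inequality (`LatticeLandscape → stub_cauchyBornBarlowCoercivity`).**
If for some `κ > 0`, for every periodic Hägg word `s` and every continuous linear automorphism `G` of `ℝ³` in the
`4/5–6/5` tube there is a box cell `(A, a, h)` (`A` a linear isometry, `47/50 ≤ a ≤ 1`, `39a/50 ≤ h ≤ 17a/20`) such
that at every unit-template site `p₁ = barlowPos 1 (√6/3) s m u v` of norm `≤ 3`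
`p⁻¹∑_{n<p} barlowSiteEnergy V_LJ a h s n + κ·dist(G p₁, A p_{a,h})² ≤ p⁻¹∑_{n<p} ½∑'_{q∈ℤ³} V_LJ(dist (G x_n) (G x_q))`
(`x_q` the unit-template sites), then CBBC holds with the same `κ`: given the far-from-family premise at scale
`r`, the cell `(A, a, h)` has a witness site with `r ≤ dist(G p₁, A p_{a,h})`, the left-hand side dominates
`e* + κ r²` (`e* ≤ e(barlowPeriodicConfiguration s a h) = p⁻¹∑ barlowSiteEnergy` by `ciInf_le` and
`energyPerParticle_barlow_eq_average`), and the right-hand side is the energy per particle of the linear image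
(`energyPerParticle_linearImage_barlow_eq_average`). [folklore] -/
theorem stub_cauchyBornBarlowCoercivity_of_latticeLandscape :
    (∃ κ : ℝ, 0 < κ ∧ ∀ (s : ℤ → ℤ) (p : ℕ) (hp : p ≠ 0) (hs : ∀ i, s (i + p) = s i), IsHaggSeq s →
      ∀ (G : EuclideanSpace ℝ (Fin 3) ≃L[ℝ] EuclideanSpace ℝ (Fin 3)),
        (∀ v : EuclideanSpace ℝ (Fin 3), 4 / 5 * ‖v‖ ≤ ‖G v‖ ∧ ‖G v‖ ≤ 6 / 5 * ‖v‖) →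
        ∃ (A : EuclideanSpace ℝ (Fin 3) →ₗᵢ[ℝ] EuclideanSpace ℝ (Fin 3)) (a h : ℝ),
          47 / 50 ≤ a ∧ a ≤ 1 ∧ 39 / 50 * a ≤ h ∧ h ≤ 17 / 20 * a ∧
          ∀ m u v : ℤ, ‖barlowPos 1 (Real.sqrt 6 / 3) s m u v‖ ≤ 3 →
            (∑ n ∈ Finset.range p, barlowSiteEnergy lennardJones a h s n) / p +
                κ * dist (G (barlowPos 1 (Real.sqrt 6 / 3) s m u v)) (A (barlowPos a h s m u v)) ^ 2 ≤
              (∑ n ∈ Finset.range p, (1 / 2 : ℝ) * ∑' q : ℤ × ℤ × ℤ,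
                lennardJones (dist (G (barlowPos 1 (Real.sqrt 6 / 3) s n 0 0))
                  (G (barlowPos 1 (Real.sqrt 6 / 3) s q.1 q.2.1 q.2.2)))) / p) →
    ∃ κ : ℝ, 0 < κ ∧ ∀ (s : ℤ → ℤ) (p : ℕ) (hp : p ≠ 0) (hs : ∀ i, s (i + p) = s i), IsHaggSeq s →
      ∀ (G : EuclideanSpace ℝ (Fin 3) ≃L[ℝ] EuclideanSpace ℝ (Fin 3)),
        (∀ v : EuclideanSpace ℝ (Fin 3), 4 / 5 * ‖v‖ ≤ ‖G v‖ ∧ ‖G v‖ ≤ 6 / 5 * ‖v‖) →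
        ∀ r : ℝ, 0 ≤ r →
          (∀ (A : EuclideanSpace ℝ (Fin 3) →ₗᵢ[ℝ] EuclideanSpace ℝ (Fin 3)) (a h : ℝ), 47 / 50 ≤ a → a ≤ 1 → 39 / 50 * a ≤ h → h ≤ 17 / 20 * a →
            ∃ m u v : ℤ, ‖barlowPos 1 (Real.sqrt 6 / 3) s m u v‖ ≤ 3 ∧
              r ≤ dist (G (barlowPos 1 (Real.sqrt 6 / 3) s m u v)) (A (barlowPos a h s m u v))) →
          (⨅ Q : PeriodicConfiguration 3, Q.energyPerParticle lennardJones) + κ * r ^ 2 ≤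
            ((barlowPeriodicConfiguration s one_ne_zero
                (div_ne_zero (Real.sqrt_ne_zero'.2 (by norm_num)) three_ne_zero : Real.sqrt 6 / 3 ≠ 0) hp hs).linearImage
              G).energyPerParticle lennardJones := by
  rintro ⟨κ, hκ, hL⟩
  refine ⟨κ, hκ, ?_⟩
  intro s p hp hs hH G hG r hr hfar
  obtain ⟨A, a, h, ha1, ha2, hh1, hh2, hmain⟩ := hL s p hp hs hH G hG
  obtain ⟨m, u, v, hn, hrd⟩ := hfar A a h ha1 ha2 hh1 hh2
  have key := hmain m u v hn
  have ha : 0 < a := by linarith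
  have hh : 0 < h := by nlinarith
  -- `e* ≤ e(barlowPeriodicConfiguration s a h) = p⁻¹ ∑ barlowSiteEnergy`
  have hfloor : (⨅ Q : PeriodicConfiguration 3, Q.energyPerParticle lennardJones) ≤
      (∑ n ∈ Finset.range p, barlowSiteEnergy lennardJones a h s n) / p := by
    rw [← energyPerParticle_barlow_eq_average ha hh ha.ne' hh.ne' hp hs]
    exact ciInf_le bddBelow_energyPerParticle_lennardJones _
  -- the right-hand side is the energy of the linear image
  have hident := energyPerParticle_linearImage_barlow_eq_average lennardJones lennardJones_zero one_pos
    cbbc_sqrt_six_div_three_pos one_ne_zero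
    (div_ne_zero (Real.sqrt_ne_zero'.2 (by norm_num)) three_ne_zero : Real.sqrt 6 / 3 ≠ 0) hp hs G
  rw [hident]
  -- `κ r² ≤ κ dist²`
  have hr2 : r ^ 2 ≤ dist (G (barlowPos 1 (Real.sqrt 6 / 3) s m u v)) (A (barlowPos a h s m u v)) ^ 2 :=
    pow_le_pow_left₀ hr hrd 2
  have hκr := mul_le_mul_of_nonneg_left hr2 hκ.le
  linarith

end Summit.AtomisticToContinuum.Crystallization.Theorems.NashClassCertificatesNashNearField

end
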